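import Literature.AlgebraicGeometry.AbelianSchemes.WeilUnitOfTorsionPoint
import Literature.AlgebraicGeometry.AbelianSchemes.MulNKernelPairOfTorsion
import Literature.AlgebraicGeometry.Morphisms.TrivialisationFpqcDescent
import Literature.AlgebraicGeometry.Modules.RankOneDescentAlongH0Iso
import HarnessLib

/-!
# Non-degeneracy of the Weil unit, descent half: a trivialisation of `[n]^*L_ŷ` whose cofaces agree on the kernel pair of `[n]` forces `ŷ = 1`
# ([Mumford AV] §15 Thm. 1, proof; §20 p. 184; fpqc descent [SGA1] VIII 1.1)

Topic `Literature/AlgebraicGeometry/AbelianSchemes`; namespace `Literature.AlgebraicGeometry.AbelianSchemes.AbelianSchemeOver` (§1) and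
`….AbelianSchemeOver.DualPair` (§2).  ONE plumbing `def` (`torsionTautSection'`, the tautological torsion section read on `A ×_S A[n]_T`-as-`A_{T'}`)
+ theorems; no named fact, no instance, no notation, no `sorry`.  Cell `hodgecm-mathlib` (D-0151), FLOOR 0, P6 «MOD programme» (crux hLiu418 =
stmt-HodgeConjecture-24832), W-line letter `stub_W1` «WeilPairingNatural», σ1 road (memo `F0/P6/B-p08/g32/ROAD-sigma1-WeilPairingNatural.v1.B-p08g32.md`),
organ (σ1-d3) «NON-DEGENERACY FROM COFACE AGREEMENT» — the descent half of (σ1-d), over ★ p846717 `MulNKernelPairOfTorsion` (the kernel pair of `[n]`),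
★ `Morphisms/TrivialisationFpqcDescent` (fpqc descent of a generator whose cofaces agree) and ★ (K1) `PoincareSheafMulNKernel.eq_one_of_nonempty_pullbackP_iso_unit`.
The remaining half (σ1-d2) «`weilUnit ≡ 1` at the tautological section ⇒ the cofaces agree» (★ p846716 `WeilUnitOfTorsionPoint`, ★
`DiscrepancyInvariantSection`) plugs into `hcof` below.  HC_CM is proved only modulo the printed citations until rung 0 closes; nothing here is about HC.

THE PRINT.  [MumfordAV1970] §15 Thm. 1 (p. 143), proof: for `L ∈ Pic⁰(X)` with `n_X^* L ≅ 𝒪_X`, the line bundle `L` is recovered from the trivial bundle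
by DESCENT along the `X_n`-torsor `n_X : X → X`; the descent datum is the action of `X_n` on the trivialisation, and `L ≅ 𝒪_X` iff that action is trivial
(§20 p. 184: `e_n(·, L) ≡ 1`).  In scheme language: `[n]` is affine (finite, ★ `isFinite_pow_id_left_of_ne_zero`), flat (★ `flat_pow_id_left_of_ne_zero`)
and surjective (★ `surjective_pow_id_left_of_ne_zero`); its kernel pair is `A_T ×_T A_T[n] ⇉ A_T` with the projection and «translate by the
tautological `n`-torsion section, then project» (★ `isPullback_fst_translation_mulN`), here moved to the base change `A_{T'}`, `T' := A_T[n]` (★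
`baseChangeCompGrpIso`); if the two cofaces of the generator `φ₀⁻¹(1)` of `[n]^* L_ŷ` agree there, ★ `nonempty_iso_unit_of_cofaceFst_eq_cofaceSnd` descends it
to `L_ŷ ≅ 𝒪`, and ★ (K1) gives `ŷ = 1` ([SGA1] VIII Thm. 1.1 ∕ [StacksProject] Tag 023M for the descent of sections).

WHAT IS HERE (`A/S` abelian, `D = (Â, 𝒫)` + `hD`, `f : T → S` with `A_T` commutative, `c` a `T`-point of `Â`, `n ≠ 0` — NO hypothesis on `S` or `T` in this half; `B := A.baseChange f`, `t := (B.torsion n).hom`, `Z := (A.baseChange (t ≫ f)).left`, `q := A.baseChangeRestrict f t`):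
* §1 `torsionTautSection' A n f : (A.baseChange (t ≫ f)).Sections` (★ `torsionTautSection` of `B` moved along ★ `baseChangeCompGrpIso f t`),
  `torsionTautSection'_comp_hom`, `torsionTautSection'_pow`, `torsionTautSection'_mem`, `translation_torsionTautSection'_left_comp_hom` (translations
  correspond under the group isomorphism, ★ `translation_comp_hom`), `translation_torsionTautSection'_comp_baseChangeRestrict_comp_mulN`
  (`(t_{x₀′} ≫ q) ≫ [n] = q ≫ [n]`), **`isPullback_baseChangeRestrict_translation_mulN`** — THE KERNEL PAIR OF `[n]_{A_T}` ON `Z`: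
  `IsPullback q (t_{x₀′} ≫ q) [n] [n]`;
* §2 **`DualPair.eq_one_of_cofaces_agree`** — for ANY trivialisation `φ₀ : [n]^* L_c ≅ 𝒪` whose generator `φ₀⁻¹(1)` has equal cofaces along that kernel
  pair (hypothesis `hcof`, VERBATIM the shape of ★ `nonempty_iso_unit_of_cofaceFst_eq_cofaceSnd` with `u := 1`), `c = 1`.

## References
* [MumfordAV1970] D. Mumford, *Abelian Varieties* (1970), §15 Thm. 1 (p. 143), §20 (p. 184), §7 Thm. 4 (p. 72).
* [SGA1] A. Grothendieck, *SGA 1*, Exp. VIII §1, Thm. 1.1, Cor. 1.2.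
* [StacksProject] The Stacks Project, Tag 023M.
* [GortzWedhorn2020] U. Görtz, T. Wedhorn, *Algebraic Geometry I*, 2nd ed. (2020), Thm. 14.66, Definition 4.45 (2) (p. 117), Section (4.7) (p. 108).
-/

set_option autoImplicit false

noncomputable section

-- `(A.baseChange g).X.left = pullback A.X.hom g` and the pulled-back module carriers are definitional only above `instances` transparency
-- (as in ★ `MulNKernelPairOfTorsion`, ★ `WeilUnitOfTorsionPoint`, ★ `TrivialisationFpqcDescent`).
set_option backward.isDefEq.respectTransparency false

universe u

open CategoryTheory CategoryTheory.Limits AlgebraicGeometry MonoidalCategory CartesianMonoidalCategory TopologicalSpace Opposite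
open scoped MonObj CategoryTheory.Obj

namespace Literature.AlgebraicGeometry.AbelianSchemes.AbelianSchemeOver

open Literature.AlgebraicGeometry.GroupSchemes Literature.AlgebraicGeometry.Modules Literature.AlgebraicGeometry.Morphisms

/-! ## §1 The kernel pair of `[n]_{A_T}`, read on `A_{T'}` with `T' := A_T[n]` -/

section KernelPair

variable {S : Scheme.{u}} (A : AbelianSchemeOver S) (n : ℕ) {T : Scheme.{u}} (f : T ⟶ S)

/-- **The tautological `n`-torsion section read on `A_{T'} = A ×_S T'`, `T' := A_T[n]`**: ★ `torsionTautSection` of `A_T` (a section of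
`A_T ×_T T'`) moved along the group isomorphism ★ `baseChangeCompGrpIso f t : A_{T'} ≅ (A_T)_{T'}`. [cite: MumfordAV1970, §15 Thm. 1 (p. 143)] -/
def torsionTautSection' : (A.baseChange (((A.baseChange f).torsion n).hom ≫ f)).Sections :=
  (A.baseChange f).torsionTautSection n ≫ (A.baseChangeCompGrpIso f ((A.baseChange f).torsion n).hom).inv.hom.hom

/-- `x₀′ ≫ ψ = x₀`. [cite: MumfordAV1970, §15 Thm. 1 (p. 143)] -/
theorem torsionTautSection'_comp_hom :
    A.torsionTautSection' n f ≫ (A.baseChangeCompGrpIso f ((A.baseChange f).torsion n).hom).hom.hom.hom =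
      (A.baseChange f).torsionTautSection n := by
  ext : 1
  rw [Over.comp_left, torsionTautSection', Over.comp_left, Category.assoc, baseChangeCompGrpIso_inv_left_hom_left]
  exact Category.comp_id _

/-- `x₀′ ^ n = 1` (★ `torsionTautSection_pow` transported along the group isomorphism). [cite: MumfordAV1970, §20 (p. 184)] -/
theorem torsionTautSection'_pow : A.torsionTautSection' n f ^ n = 1 := by
  have hpow : ∀ m : ℕ, A.torsionTautSection' n f ^ m =
      ((A.baseChange f).torsionTautSection n ^ m) ≫ (A.baseChangeCompGrpIso f ((A.baseChange f).torsion n).hom).inv.hom.hom := by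
    intro m
    induction m with
    | zero => rw [pow_zero, pow_zero, MonObj.one_comp]
    | succ m ih => rw [pow_succ, pow_succ, ih, torsionTautSection', MonObj.mul_comp]
  rw [hpow, torsionTautSection_pow, MonObj.one_comp]

/-- `x₀′` is an `n`-torsion section of `A_{T'}`. [cite: MumfordAV1970, §20 (p. 184)] -/
theorem torsionTautSection'_mem [IsCommMonObj (A.baseChange (((A.baseChange f).torsion n).hom ≫ f)).X] :
    A.torsionTautSection' n f ∈ (A.baseChange (((A.baseChange f).torsion n).hom ≫ f)).torsionSections n :=
  ((A.baseChange _).mem_torsionSections_iff n _).2 (A.torsionTautSection'_pow n f)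

/-- **Translations correspond under `ψ : A_{T'} ≅ (A_T)_{T'}`**: `t_{x₀′} ≫ ψ = ψ ≫ t_{x₀}` on underlying schemes (★ `translation_comp_hom`).
[cite: GortzWedhorn2023, Def./Rem. 27.1 (p. 604)] -/
@[reassoc]
theorem translation_torsionTautSection'_left_comp_hom :
    ((A.baseChange (((A.baseChange f).torsion n).hom ≫ f)).translation (A.torsionTautSection' n f)).left ≫
        (A.baseChangeCompGrpIso f ((A.baseChange f).torsion n).hom).hom.hom.hom.left =
      (A.baseChangeCompGrpIso f ((A.baseChange f).torsion n).hom).hom.hom.hom.left ≫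
        (((A.baseChange f).baseChange ((A.baseChange f).torsion n).hom).translation ((A.baseChange f).torsionTautSection n)).left := by
  rw [← Over.comp_left, translation_comp_hom, torsionTautSection'_comp_hom, Over.comp_left]

/-- `q = ψ ≫ pr` for `q : A_{T'} → A_T` (the general-`t` form of ★ `baseChangeRestrict_eq_comp`). [cite: GortzWedhorn2020, Section (4.7), (4.7.1) (p. 108)] -/
theorem baseChangeRestrict_eq_hom_left_comp_fst {T' : Scheme.{u}} (t : T' ⟶ T) :
    A.baseChangeRestrict f t = (A.baseChangeCompGrpIso f t).hom.hom.hom.left ≫ pullback.fst (A.baseChange f).X.hom t := by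
  refine pullback.hom_ext ?_ ?_
  · rw [baseChangeRestrict_comp_fst, Category.assoc]
    exact (A.baseChangeCompGrpIso_hom_left_fst_fst f t).symm
  · rw [baseChangeRestrict_comp_snd, Category.assoc]
    change _ = _ ≫ pullback.fst (A.baseChange f).X.hom t ≫ (A.baseChange f).X.hom
    rw [pullback.condition]
    change _ = _ ≫ pullback.snd (pullback.snd A.X.hom f) t ≫ t
    rw [A.baseChangeCompGrpIso_hom_left_snd_assoc f t]

/-- `(t_{x₀′} ≫ q) ≫ [n]_{A_T} = q ≫ [n]_{A_T}` (the kernel-pair square commutes). [cite: MumfordAV1970, §15 Thm. 1 (p. 143)] -/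
theorem translation_torsionTautSection'_comp_baseChangeRestrict_comp_mulN [IsCommMonObj (A.baseChange f).X] :
    (((A.baseChange (((A.baseChange f).torsion n).hom ≫ f)).translation (A.torsionTautSection' n f)).left ≫
        A.baseChangeRestrict f ((A.baseChange f).torsion n).hom) ≫ ((A.baseChange f).mulN n).left =
      A.baseChangeRestrict f ((A.baseChange f).torsion n).hom ≫ ((A.baseChange f).mulN n).left := by
  rw [baseChangeRestrict_eq_hom_left_comp_fst, ← Category.assoc, translation_torsionTautSection'_left_comp_hom, Category.assoc, Category.assoc,
    Category.assoc]
  congr 1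
  have hw := ((A.baseChange f).isPullback_fst_translation_mulN n).w
  rw [Category.assoc] at hw
  exact hw.symm

/-- **THE KERNEL PAIR OF `[n]_{A_T}` READ ON `A_{T'}`, `T' := A_T[n]`**: `IsPullback q (t_{x₀′} ≫ q) [n] [n]` — ★ `isPullback_fst_translation_mulN` (on
`A_T ×_T T'`) moved along the isomorphism of schemes underlying ★ `baseChangeCompGrpIso f t : A_{T'} ≅ (A_T)_{T'}`. [cite: MumfordAV1970, §15 Thm. 1 (p. 143)]
[cite: GortzWedhorn2020, Definition 4.45 (2) (p. 117)] -/
theorem isPullback_baseChangeRestrict_translation_mulN [IsCommMonObj (A.baseChange f).X] :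
    IsPullback (A.baseChangeRestrict f ((A.baseChange f).torsion n).hom)
      (((A.baseChange (((A.baseChange f).torsion n).hom ≫ f)).translation (A.torsionTautSection' n f)).left ≫
        A.baseChangeRestrict f ((A.baseChange f).torsion n).hom)
      ((A.baseChange f).mulN n).left ((A.baseChange f).mulN n).left := by
  have H := (A.baseChange f).isPullback_fst_translation_mulN n
  -- move the apex along the isomorphism of underlying schemes `ψ⁻¹ : (A_T)_{T'} ≅ A_{T'}`
  refine H.of_iso
    ⟨(A.baseChangeCompGrpIso f ((A.baseChange f).torsion n).hom).inv.hom.hom.left,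
      (A.baseChangeCompGrpIso f ((A.baseChange f).torsion n).hom).hom.hom.hom.left,
      A.baseChangeCompGrpIso_inv_left_hom_left f _, A.baseChangeCompGrpIso_hom_left_inv_left f _⟩
    (Iso.refl _) (Iso.refl _) (Iso.refl _) ?_ ?_ (by simp) (by simp)
  · rw [Iso.refl_hom, Category.comp_id, baseChangeRestrict_eq_hom_left_comp_fst, baseChangeCompGrpIso_inv_left_hom_left_assoc]
  · rw [Iso.refl_hom, Category.comp_id, baseChangeRestrict_eq_hom_left_comp_fst, translation_torsionTautSection'_left_comp_hom_assoc,
      baseChangeCompGrpIso_inv_left_hom_left_assoc]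

end KernelPair

/-! ## §2 Non-degeneracy from coface agreement -/

namespace DualPair

variable {S : Scheme.{u}} {A : AbelianSchemeOver S} (D : A.DualPair)
  (hD : Nonempty ((Scheme.Modules.pullback (DualPair.unitHatSlice D)).obj D.P ≅ SheafOfModules.unit _)) {n : ℕ} (hn : n ≠ 0)
  {T : Scheme.{u}} (f : T ⟶ S) [IsCommMonObj (A.baseChange f).X] (c : Over.mk f ⟶ D.hat.X)

include hD hn in
/-- **NON-DEGENERACY OF THE WEIL UNIT, DESCENT HALF.**  Let `φ₀ : [n]^* L_c ≅ 𝒪` be ANY trivialisation of the pull-back along `[n] : A_T → A_T` of the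
slice `L_c = (1 × c)^*𝒫` of a `T`-point `c` of `Â` (it exists when `c^n = 1`, ★ (K1)).  If the two cofaces of the generator `φ₀⁻¹(1)` along the kernel
pair `A_{T'} ⇉ A_T` of `[n]` (`T' := A_T[n]`; projection `q` and «translate by the tautological torsion section, then `q`», §1) AGREE, then `c = 1`:
the generator descends along the affine faithfully flat `[n]` to a trivialisation `L_c ≅ 𝒪` (★ `nonempty_iso_unit_of_cofaceFst_eq_cofaceSnd`, [SGA1]
VIII 1.1), and a `T`-point whose Poincaré slice is trivial is the unit (★ (K1) `eq_one_of_nonempty_pullbackP_iso_unit`, [MumfordAV1970] §8∕§13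
uniqueness).  The (σ1-d2) organ supplies `hcof` from «`weilUnit ≡ 1` at the tautological section». [cite: MumfordAV1970, §15 Thm. 1 (p. 143)]
[cite: MumfordAV1970, §20 (p. 184)] [cite: SGA1, Exp. VIII Thm. 1.1, Cor. 1.2] [cite: StacksProject, Tag 023M] -/
theorem eq_one_of_cofaces_agree
    (φ₀ : (Scheme.Modules.pullback ((A.baseChange f).mulN n).left).obj (D.pullbackP f c.left (Over.w c)) ≅
      SheafOfModules.unit (A.baseChange f).X.left.ringCatSheaf)
    (hcof : ((Scheme.Modules.pullbackComp (A.baseChangeRestrict f ((A.baseChange f).torsion n).hom) ((A.baseChange f).mulN n).left).hom.app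
          (D.pullbackP f c.left (Over.w c))).app ⊤
        (Literature.AlgebraicGeometry.Modules.unitSection (A.baseChangeRestrict f ((A.baseChange f).torsion n).hom)
          ((Scheme.Modules.pullback ((A.baseChange f).mulN n).left).obj (D.pullbackP f c.left (Over.w c))) ⊤ (φ₀.inv.app ⊤ (1 : Γ((A.baseChange f).X.left, ⊤)))) =
      ((Scheme.Modules.pullbackCongr (A.translation_torsionTautSection'_comp_baseChangeRestrict_comp_mulN n f)).hom.app
          (D.pullbackP f c.left (Over.w c))).app ⊤
        (((Scheme.Modules.pullbackComp
            ((((A.baseChange (((A.baseChange f).torsion n).hom ≫ f)).translation (A.torsionTautSection' n f)).left ≫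
              A.baseChangeRestrict f ((A.baseChange f).torsion n).hom))
            ((A.baseChange f).mulN n).left).hom.app (D.pullbackP f c.left (Over.w c))).app ⊤
          (Literature.AlgebraicGeometry.Modules.unitSection
            ((((A.baseChange (((A.baseChange f).torsion n).hom ≫ f)).translation (A.torsionTautSection' n f)).left ≫
              A.baseChangeRestrict f ((A.baseChange f).torsion n).hom))
            ((Scheme.Modules.pullback ((A.baseChange f).mulN n).left).obj (D.pullbackP f c.left (Over.w c))) ⊤ (φ₀.inv.app ⊤ (1 : Γ((A.baseChange f).X.left, ⊤)))))) :
    c = 1 := by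
  haveI : IsFinite ((A.baseChange f).mulN n).left := (A.baseChange f).isFinite_pow_id_left_of_ne_zero hn
  haveI : IsAffineHom ((A.baseChange f).mulN n).left := inferInstance
  haveI : Flat ((A.baseChange f).mulN n).left := (A.baseChange f).flat_pow_id_left_of_ne_zero hn
  haveI : Surjective ((A.baseChange f).mulN n).left := (A.baseChange f).surjective_pow_id_left_of_ne_zero hn
  haveI : (D.pullbackP f c.left (Over.w c)).IsQuasicoherent := isQuasicoherent_of_hasRank (TorsionPairing.hasRank_pullbackP D f c)
  obtain ⟨i⟩ := nonempty_iso_unit_of_cofaceFst_eq_cofaceSnd ((A.baseChange f).mulN n).left _ _ (D.pullbackP f c.left (Over.w c)) φ₀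
    (A.isPullback_baseChangeRestrict_translation_mulN n f) (1 : Γ((A.baseChange f).X.left, ⊤)) isUnit_one hcof
  exact D.eq_one_of_nonempty_pullbackP_iso_unit f hD c ⟨i⟩

end DualPair

end Literature.AlgebraicGeometry.AbelianSchemes.AbelianSchemeOver

end
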